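import Summits.AtomisticToContinuum.HydrodynamicLimit.Theorems.LambertianContactSwapLambertianWellPosedWindowMeasure
import Summits.AtomisticToContinuum.HydrodynamicLimit.Theorems.LambertianContactSwapLambertianWellPosedRegular

/-!
# Iterating the window analysis of the Lambertian recursion: the survivors

Helper file (`--supports`) of the support item `LambertianWellPosed` of route `LambertianContactSwap`
(`AtomisticToContinuum/HydrodynamicLimit`, stmt-AtomisticToContinuum-12101).
GST 2013, proof of Prop. 4.1.1, for the Lambertian recursion on `(datum, noise)` space with the measure
`vol ⊗ γ^{⊗ℕ}` and the restart map `Ψ_s (z, ξs) = (Λ_s(z; ξs), ξs (· + K_s))`: a good window gives the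
three truncated clauses up to `δ`; the survivors of `m + 1` windows are regular up to `(m+1)δ`, restart,
and do not lose measure under `Ψ_{(m+1)δ}` (the one-window estimate, `m + 1` times).
-/

noncomputable section

open MeasureTheory ProbabilityTheory Set Function Filter Metric
open scoped ENNReal InnerProductSpace Real

namespace Summit.AtomisticToContinuum.HydrodynamicLimit.Theorems

open Literature.MathematicalPhysics.KineticTheory Literature.Analysis.FluidPDE
  Literature.Analysis.FluidPDE.Alexander

open LWindow

namespace HalfAngle

/-! ## A good window: the three truncated clauses up to time `δ` -/

section WindowGood

variable {d : Type*} [Fintype d] {N : ℕ} {ε r δ V : ℝ}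

/-- **A good window**: a datum of the short-time good set in the energy shell whose first redraw is
non-degenerate along every pair of its exit configuration is forward regular up to time `δ` for the
Lambertian recursion (the three truncated clauses), by the window analysis `lambert_window_free` /
`lambert_window_hit`. [folklore] -/
theorem lambert_window_good (hε : 0 < ε) (hεr : ε + 2 * r < 2⁻¹) (hr4 : 4 * V * δ ≤ r) (hV0 : 0 ≤ V)
    (hδ : 0 ≤ δ) {z : Config N d (UnitAddTorus d)} (hz : z ∈ shortGood N ε r δ)
    (hE : configEnergy z ≤ V ^ 2 / 2) {ξs : ℕ → EuclideanSpace ℝ d}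
    (hnd : ∀ pr : Fin N × Fin N, lambertDir ((Torus.geometry d).sepVec
      (freeFlight (Torus.geometry d) (freeExitTime (Torus.geometry d) ε z).toReal z pr.1).1
      (freeFlight (Torus.geometry d) (freeExitTime (Torus.geometry d) ε z).toReal z pr.2).1) (ξs 0) ≠ 0) :
    (∀ k, lambertInstant (Torus.geometry d) ε ξs z (k + 1) ≤ ENNReal.ofReal δ →
      IsSimpleIncoming (Torus.geometry d) ε (freeFlight (Torus.geometry d)
        (freeExitTime (Torus.geometry d) ε (lambertStateAfter (Torus.geometry d) ε ξs z k)).toReal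
          (lambertStateAfter (Torus.geometry d) ε ξs z k))) ∧
    (∀ k (t : ℝ), 0 < t → ENNReal.ofReal t < freeExitTime (Torus.geometry d) ε
        (lambertStateAfter (Torus.geometry d) ε ξs z k) →
      lambertInstant (Torus.geometry d) ε ξs z k + ENNReal.ofReal t ≤ ENNReal.ofReal δ →
      ∀ a b : Fin N, a ≠ b → freeFlight (Torus.geometry d) t (lambertStateAfter (Torus.geometry d) ε ξs z k) ∉
        contactSet (Torus.geometry d) N ε a b) ∧
    (∃ k, ENNReal.ofReal δ < lambertInstant (Torus.geometry d) ε ξs z k) := by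
  have hVδ : 0 ≤ 2 * V * δ := by positivity
  have hrr : 2 * V * δ ≤ r := by nlinarith
  have hε' : ε < 2⁻¹ := by linarith
  have hV : ∀ k, ‖(z k).2‖ ≤ V := norm_vel_le_of_configEnergy_le hV0 hE
  rcases mem_shortGood.1 hz with hfar | ⟨pr, hpr, hno | hhit⟩
  · obtain ⟨h1, h2, h3, -, -⟩ := lambert_window_free hε' hδ (forall_lt_norm_of_mem_farSet hV hrr hfar) ξs
    exact ⟨h1, h2, h3⟩
  · obtain ⟨h1, h2, h3, -, -⟩ :=
      lambert_window_free hε' hδ (forall_lt_norm_of_mem_noHitPiece hε hV hrr hεr hno) ξs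
    exact ⟨h1, h2, h3⟩
  · have hh : HitHyp ε r δ V z pr.1 pr.2 := ⟨hε, hεr, hrr, hV0, hE, hpr, hhit⟩
    have hξ : lambertDir (hitPoint ε ((Torus.geometry d).sepVec (z pr.1).1 (z pr.2).1,
        (z pr.1).2 - (z pr.2).2)) (ξs 0) ≠ 0 := by
      have := hnd pr
      rwa [hh.toReal_freeExitTime, hh.sepVec_freeFlight_hitTime] at this
    obtain ⟨h1, h2, h3, -, -⟩ := lambert_window_hit hh hr4 hξ
    exact ⟨h1, h2, h3⟩

end WindowGood

/-! ## Iterating the window analysis (GST 2013, proof of Prop. 4.1.1, for the Lambertian recursion)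

Below `LSG`, `Ψ`, `Good` are ABBREVIATIONS pinned down by the hypotheses `hLSG`, `hΨ`, `hGood`:
`LSG` = the good data of one window (short-time good datum in the energy shell, first redraw
non-degenerate), `Ψ s` = the restart map `(z, ξs) ↦ (Λ_s(z; ξs), ξs (· + K_s))`, `Good T` = the three
truncated clauses up to the horizon `T`. The interaction length is `r = 4Vδ = 2 (2V) δ`. -/

section Iteration

variable {N : ℕ} {ε δ V : ℝ}
  {LSG : Set (Config N (Fin 3) (UnitAddTorus (Fin 3)) × (ℕ → EuclideanSpace ℝ (Fin 3)))}
  {Ψ : ℝ → Config N (Fin 3) (UnitAddTorus (Fin 3)) × (ℕ → EuclideanSpace ℝ (Fin 3)) →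
    Config N (Fin 3) (UnitAddTorus (Fin 3)) × (ℕ → EuclideanSpace ℝ (Fin 3))}
  {Good : ℝ → Config N (Fin 3) (UnitAddTorus (Fin 3)) × (ℕ → EuclideanSpace ℝ (Fin 3)) → Prop}

/-- **Restart** for the abbreviations: `Good s q → Good u (Ψ s q) → Good (s + u) q` and
`Ψ (s + u) q = Ψ u (Ψ s q)` (`LRestart.lambert_fwdGoodUpTo_add` and the additivity of the collision
count `LRestart.lambertCount_add_of_segment`). [folklore] -/
theorem lambert_good_restart
    (hΨ : Ψ = fun s q => (lambertFlow (Torus.geometry (Fin 3)) ε q.2 q.1 s,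
      fun n => q.2 (n + lambertCount (Torus.geometry (Fin 3)) ε q.2 q.1 s)))
    (hGood : Good = fun T q =>
      (∀ k, lambertInstant (Torus.geometry (Fin 3)) ε q.2 q.1 (k + 1) ≤ ENNReal.ofReal T →
        IsSimpleIncoming (Torus.geometry (Fin 3)) ε (freeFlight (Torus.geometry (Fin 3))
          (freeExitTime (Torus.geometry (Fin 3)) ε (lambertStateAfter (Torus.geometry (Fin 3)) ε q.2 q.1 k)).toReal
          (lambertStateAfter (Torus.geometry (Fin 3)) ε q.2 q.1 k))) ∧
      (∀ k (t : ℝ), 0 < t → ENNReal.ofReal t <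
          freeExitTime (Torus.geometry (Fin 3)) ε (lambertStateAfter (Torus.geometry (Fin 3)) ε q.2 q.1 k) →
        lambertInstant (Torus.geometry (Fin 3)) ε q.2 q.1 k + ENNReal.ofReal t ≤ ENNReal.ofReal T →
        ∀ a b : Fin N, a ≠ b →
          freeFlight (Torus.geometry (Fin 3)) t (lambertStateAfter (Torus.geometry (Fin 3)) ε q.2 q.1 k) ∉
            contactSet (Torus.geometry (Fin 3)) N ε a b) ∧
      (∃ k, ENNReal.ofReal T < lambertInstant (Torus.geometry (Fin 3)) ε q.2 q.1 k))
    {s u : ℝ} (hs : 0 ≤ s) (hu : 0 ≤ u)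
    {q : Config N (Fin 3) (UnitAddTorus (Fin 3)) × (ℕ → EuclideanSpace ℝ (Fin 3))}
    (h1 : Good s q) (h2 : Good u (Ψ s q)) :
    Good (s + u) q ∧ Ψ (s + u) q = Ψ u (Ψ s q) := by
  subst hΨ hGood
  dsimp only at h1 h2 ⊢
  obtain ⟨hz1, hz2, hz3⟩ := h1
  obtain ⟨hw1, hw2, hw3⟩ := h2
  obtain ⟨g1, g2, g3, hflow⟩ := LRestart.lambert_fwdGoodUpTo_add hs hu hz1 hz2 hz3 hw1 hw2 hw3
  refine ⟨⟨g1, g2, g3⟩, Prod.ext hflow ?_⟩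
  -- the collision counts add
  obtain ⟨k, hk1, hk2⟩ := LRestart.exists_lambert_segment hz3 le_rfl
  have hK : lambertCount (Torus.geometry (Fin 3)) ε q.2 q.1 s = k := lambertCount_eq_of_segment hk1 hk2
  rw [hK] at hw3
  obtain ⟨m, hm1, hm2⟩ := LRestart.exists_lambert_segment hw3 le_rfl
  have hK' : lambertCount (Torus.geometry (Fin 3)) ε (fun n => q.2 (n + k))
      (lambertFlow (Torus.geometry (Fin 3)) ε q.2 q.1 s) u = m := lambertCount_eq_of_segment hm1 hm2
  have hKsu : lambertCount (Torus.geometry (Fin 3)) ε q.2 q.1 (s + u) = k + m :=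
    LRestart.lambertCount_add_of_segment hs hu hk1 hk2 hm1 hm2
  funext n
  show q.2 (n + lambertCount (Torus.geometry (Fin 3)) ε q.2 q.1 (s + u)) =
    q.2 (n + lambertCount (Torus.geometry (Fin 3)) ε
      (fun n => q.2 (n + lambertCount (Torus.geometry (Fin 3)) ε q.2 q.1 s))
      (lambertFlow (Torus.geometry (Fin 3)) ε q.2 q.1 s) u + lambertCount (Torus.geometry (Fin 3)) ε q.2 q.1 s)
  rw [hK, hK', hKsu, Nat.add_right_comm, Nat.add_assoc]

/-- **Regularity and restart of the survivors**: a datum of `LSG` whose restarts at the times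
`δ, 2δ, …, mδ` are in `LSG` is good up to `(m+1)δ`; and if moreover its restart at `(m+1)δ` is in
`LSG`, the restart at `(m+1)δ + δ` is the one-window restart of the restart at `(m+1)δ`
(GST 2013, proof of Prop. 4.1.1, for the Lambertian recursion). [cite: GST2013, proof of Prop. 4.1.1 p. 19] -/
theorem lambert_iterGood_good (hε : 0 < ε) (hch : ε + 2 * (2 * (2 * V) * δ) < 2⁻¹) (hV0 : 0 ≤ V) (hδ : 0 ≤ δ)
    (hLSG : LSG = {q | q.1 ∈ shortGood N ε (2 * (2 * V) * δ) δ ∧ configEnergy q.1 ≤ V ^ 2 / 2 ∧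
      ∀ pr : Fin N × Fin N, lambertDir ((Torus.geometry (Fin 3)).sepVec
        (freeFlight (Torus.geometry (Fin 3)) (freeExitTime (Torus.geometry (Fin 3)) ε q.1).toReal q.1 pr.1).1
        (freeFlight (Torus.geometry (Fin 3)) (freeExitTime (Torus.geometry (Fin 3)) ε q.1).toReal q.1 pr.2).1)
        (q.2 0) ≠ 0})
    (hΨ : Ψ = fun s q => (lambertFlow (Torus.geometry (Fin 3)) ε q.2 q.1 s,
      fun n => q.2 (n + lambertCount (Torus.geometry (Fin 3)) ε q.2 q.1 s)))
    (hGood : Good = fun T q =>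
      (∀ k, lambertInstant (Torus.geometry (Fin 3)) ε q.2 q.1 (k + 1) ≤ ENNReal.ofReal T →
        IsSimpleIncoming (Torus.geometry (Fin 3)) ε (freeFlight (Torus.geometry (Fin 3))
          (freeExitTime (Torus.geometry (Fin 3)) ε (lambertStateAfter (Torus.geometry (Fin 3)) ε q.2 q.1 k)).toReal
          (lambertStateAfter (Torus.geometry (Fin 3)) ε q.2 q.1 k))) ∧
      (∀ k (t : ℝ), 0 < t → ENNReal.ofReal t <
          freeExitTime (Torus.geometry (Fin 3)) ε (lambertStateAfter (Torus.geometry (Fin 3)) ε q.2 q.1 k) →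
        lambertInstant (Torus.geometry (Fin 3)) ε q.2 q.1 k + ENNReal.ofReal t ≤ ENNReal.ofReal T →
        ∀ a b : Fin N, a ≠ b →
          freeFlight (Torus.geometry (Fin 3)) t (lambertStateAfter (Torus.geometry (Fin 3)) ε q.2 q.1 k) ∉
            contactSet (Torus.geometry (Fin 3)) N ε a b) ∧
      (∃ k, ENNReal.ofReal T < lambertInstant (Torus.geometry (Fin 3)) ε q.2 q.1 k))
    (m : ℕ) :
    (∀ q, q ∈ LSG → (∀ k, k < m → Ψ (((k : ℝ) + 1) * δ) q ∈ LSG) → Good (((m : ℝ) + 1) * δ) q) ∧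
    (∀ q, q ∈ LSG → (∀ k, k < m + 1 → Ψ (((k : ℝ) + 1) * δ) q ∈ LSG) →
      Ψ (((m : ℝ) + 1) * δ + δ) q = Ψ δ (Ψ (((m : ℝ) + 1) * δ) q)) := by
  have hr4 : 4 * V * δ ≤ 2 * (2 * V) * δ := le_of_eq (by ring)
  -- a good window
  have hW : ∀ q, q ∈ LSG → Good δ q := by
    intro q hq
    rw [hLSG] at hq
    obtain ⟨hsg, hE, hnd⟩ := hq
    rw [hGood]
    exact lambert_window_good hε hch hr4 hV0 hδ hsg hE hnd
  have hA : ∀ m : ℕ, ∀ q, q ∈ LSG → (∀ k : ℕ, k < m → Ψ (((k : ℝ) + 1) * δ) q ∈ LSG) →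
      Good (((m : ℝ) + 1) * δ) q := by
    intro m
    induction m with
    | zero =>
      intro q hq _
      simpa using hW q hq
    | succ m ih =>
      intro q hq hiter
      have hreg := ih q hq fun k hk => hiter k (Nat.lt_succ_of_lt hk)
      have hw := hW _ (hiter m (Nat.lt_succ_self m))
      have hm0 : 0 ≤ ((m : ℝ) + 1) * δ := by positivity
      have h := (lambert_good_restart hΨ hGood hm0 hδ hreg hw).1
      have hcast : (((m + 1 : ℕ) : ℝ) + 1) * δ = ((m : ℝ) + 1) * δ + δ := by push_cast; ring
      rwa [hcast]
  refine ⟨hA m, fun q hq hiter => ?_⟩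
  have hreg := hA m q hq fun k hk => hiter k (Nat.lt_succ_of_lt hk)
  have hw := hW _ (hiter m (Nat.lt_succ_self m))
  have hm0 : 0 ≤ ((m : ℝ) + 1) * δ := by positivity
  exact (lambert_good_restart hΨ hGood hm0 hδ hreg hw).2

/-- **The survivors do not lose measure under the restart map**: for measurable `B`,
`μ {q ∈ literGood m | Ψ_{(m+1)δ} q ∈ B} ≤ μ B`, `μ = vol ⊗ γ^{⊗ℕ}` (induction on `m` with the
one-window estimate `lambert_window_measure_le`). [cite: GST2013, proof of Prop. 4.1.1 p. 19] -/
theorem lambert_iterGood_measure_le (hε : 0 < ε) (hch : ε + 2 * (2 * (2 * V) * δ) < 2⁻¹) (hV0 : 0 ≤ V)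
    (hδ : 0 ≤ δ)
    (hLSG : LSG = {q | q.1 ∈ shortGood N ε (2 * (2 * V) * δ) δ ∧ configEnergy q.1 ≤ V ^ 2 / 2 ∧
      ∀ pr : Fin N × Fin N, lambertDir ((Torus.geometry (Fin 3)).sepVec
        (freeFlight (Torus.geometry (Fin 3)) (freeExitTime (Torus.geometry (Fin 3)) ε q.1).toReal q.1 pr.1).1
        (freeFlight (Torus.geometry (Fin 3)) (freeExitTime (Torus.geometry (Fin 3)) ε q.1).toReal q.1 pr.2).1)
        (q.2 0) ≠ 0})
    (hΨ : Ψ = fun s q => (lambertFlow (Torus.geometry (Fin 3)) ε q.2 q.1 s,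
      fun n => q.2 (n + lambertCount (Torus.geometry (Fin 3)) ε q.2 q.1 s)))
    (m : ℕ) {B : Set (Config N (Fin 3) (UnitAddTorus (Fin 3)) × (ℕ → EuclideanSpace ℝ (Fin 3)))}
    (hB : MeasurableSet B) :
    ((volume : Measure (Config N (Fin 3) (UnitAddTorus (Fin 3)))).prod (lambertNoise (Fin 3)))
      {q | q ∈ LSG ∧ (∀ k, k < m → Ψ (((k : ℝ) + 1) * δ) q ∈ LSG) ∧ Ψ (((m : ℝ) + 1) * δ) q ∈ B} ≤
    ((volume : Measure (Config N (Fin 3) (UnitAddTorus (Fin 3)))).prod (lambertNoise (Fin 3))) B := by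
  have hr4 : 4 * V * δ ≤ 2 * (2 * V) * δ := le_of_eq (by ring)
  have hε' : ε < 2⁻¹ := by
    have : 0 ≤ 2 * (2 * (2 * V) * δ) := by positivity
    linarith
  have hGr := Torus.isHardSphereRegular_geometry (d := Fin 3) hε'
  have hGm : (Torus.geometry (Fin 3)).IsMeasurable := Torus.isMeasurable_geometry
  have hLSGm : MeasurableSet LSG := by
    have h1 : MeasurableSet {q : Config N (Fin 3) (UnitAddTorus (Fin 3)) × (ℕ → EuclideanSpace ℝ (Fin 3)) |
        q.1 ∈ shortGood N ε (2 * (2 * V) * δ) δ} := measurable_fst (measurableSet_shortGood ε _ δ)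
    have h2 : MeasurableSet {q : Config N (Fin 3) (UnitAddTorus (Fin 3)) × (ℕ → EuclideanSpace ℝ (Fin 3)) |
        configEnergy q.1 ≤ V ^ 2 / 2} := measurable_fst (measurableSet_energyShell _)
    have h3 : MeasurableSet {q : Config N (Fin 3) (UnitAddTorus (Fin 3)) × (ℕ → EuclideanSpace ℝ (Fin 3)) |
        ∀ pr : Fin N × Fin N, lambertDir ((Torus.geometry (Fin 3)).sepVec
          (freeFlight (Torus.geometry (Fin 3)) (freeExitTime (Torus.geometry (Fin 3)) ε q.1).toReal q.1 pr.1).1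
          (freeFlight (Torus.geometry (Fin 3)) (freeExitTime (Torus.geometry (Fin 3)) ε q.1).toReal q.1 pr.2).1)
          (q.2 0) ≠ 0} := by
      have h := ((measurableSet_degenerateRedraw (N := N) hGr hGm).compl).preimage
        (measurable_fst.prodMk ((measurable_pi_apply 0).comp measurable_snd) :
          Measurable fun q : Config N (Fin 3) (UnitAddTorus (Fin 3)) × (ℕ → EuclideanSpace ℝ (Fin 3)) =>
            (q.1, q.2 0))
      convert h using 1
      ext q
      simp only [ne_eq, mem_setOf_eq, preimage_compl, mem_compl_iff, mem_preimage, not_exists]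
    rw [hLSG]
    exact h1.inter (h2.inter h3)
  have hΨm : ∀ s, Measurable (Ψ s) := by
    intro s
    rw [hΨ]
    refine (measurable_lambertFlow hGr hGm s).prodMk ?_
    have hF : Measurable fun p : ℕ × (Config N (Fin 3) (UnitAddTorus (Fin 3)) × (ℕ → EuclideanSpace ℝ (Fin 3))) =>
        fun n => p.2.2 (n + p.1) :=
      measurable_from_prod_countable_right fun k =>
        measurable_pi_lambda _ fun n => (measurable_pi_apply (n + k)).comp measurable_snd
    exact hF.comp ((measurable_lambertCount hGr hGm s).prodMk measurable_id)
  induction m generalizing B with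
  | zero =>
    refine le_trans (measure_mono fun q hq => ?_)
      (lambert_window_measure_le (r := 2 * (2 * V) * δ) hε hch hr4 hV0 hδ hB)
    obtain ⟨hq, -, hqB⟩ := hq
    rw [hLSG] at hq
    simp only [Nat.cast_zero, zero_add, one_mul] at hqB
    rw [hΨ] at hqB
    exact ⟨hq.1, hq.2.1, hq.2.2, hqB⟩
  | succ m ih =>
    set B' : Set (Config N (Fin 3) (UnitAddTorus (Fin 3)) × (ℕ → EuclideanSpace ℝ (Fin 3))) :=
      {w | w ∈ LSG ∧ Ψ δ w ∈ B} with hB'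
    have hB'm : MeasurableSet B' := hLSGm.inter (hΨm δ hB)
    have hcast : (((m + 1 : ℕ) : ℝ) + 1) * δ = ((m : ℝ) + 1) * δ + δ := by push_cast; ring
    calc ((volume : Measure (Config N (Fin 3) (UnitAddTorus (Fin 3)))).prod (lambertNoise (Fin 3)))
          {q | q ∈ LSG ∧ (∀ k, k < m + 1 → Ψ (((k : ℝ) + 1) * δ) q ∈ LSG) ∧
            Ψ ((((m + 1 : ℕ) : ℝ) + 1) * δ) q ∈ B}
        ≤ ((volume : Measure (Config N (Fin 3) (UnitAddTorus (Fin 3)))).prod (lambertNoise (Fin 3)))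
          {q | q ∈ LSG ∧ (∀ k, k < m → Ψ (((k : ℝ) + 1) * δ) q ∈ LSG) ∧ Ψ (((m : ℝ) + 1) * δ) q ∈ B'} := by
          refine measure_mono fun q hq => ?_
          obtain ⟨hq1, hiter, hqB⟩ := hq
          refine ⟨hq1, fun k hk => hiter k (Nat.lt_succ_of_lt hk), hiter m (Nat.lt_succ_self m), ?_⟩
          have hflow := (lambert_iterGood_good hε hch hV0 hδ hLSG hΨ rfl m).2 q hq1 hiter
          rw [hcast, hflow] at hqB
          exact hqB
      _ ≤ ((volume : Measure (Config N (Fin 3) (UnitAddTorus (Fin 3)))).prod (lambertNoise (Fin 3))) B' := ih hB'm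
      _ ≤ ((volume : Measure (Config N (Fin 3) (UnitAddTorus (Fin 3)))).prod (lambertNoise (Fin 3))) B := by
          refine le_trans (measure_mono fun w hw => ?_)
            (lambert_window_measure_le (r := 2 * (2 * V) * δ) hε hch hr4 hV0 hδ hB)
          obtain ⟨hw, hwB⟩ := hw
          rw [hLSG] at hw
          rw [hΨ] at hwB
          exact ⟨hw.1, hw.2.1, hw.2.2, hwB⟩

end Iteration

end HalfAngle

end Summit.AtomisticToContinuum.HydrodynamicLimit.Theorems
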